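import Literature.Geometry.Lorentzian.CarterThresholdKernelBookkeeping
import HarnessLib

/-!
# Polynomial bookkeeping for the superradiant BF-stable cone kernel bound, I: the far constant at the
# start `ζ = θ₁M/4`, the near length and the reciprocal zone rate as powers of one master variable
(namespace `Literature.Geometry.Lorentzian.Kerr`; pure real arithmetic.)

Companion of `CarterThresholdKernelBookkeeping` (far start `ζ = θ₁M/2`, transport exponent `2`). In the
superradiant Breitenlohner–Freedman-stable sector the barrier of Carter's coefficient is only known to
reach `r₊(1 + θ₁/4) ≥ r₊ + θ₁M/4` (`Kerr.le_rho_of_forbidden_eq_Icc`), so the `𝓘⁺`-envelope is restarted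
at `ζ = θ₁M/4` with the same auxiliary exponent `η = θ₁/(100M)`; the transport exponent becomes `4`:

* `expArg_eq_four`, `exp_four_le` — `2η·50M²/(θ₁M/4) = 4` and `e⁴ ≤ 64`;
* `farConstant_B4_le_pow` — `B = (Φ/η²)¹⁶·e⁴·(η²(2 + 2|ω|R)² + 2ω²) ≤ c_B⁗·Y^105`,
  `c_B⁗ = 64·678·(7·10⁴)¹⁶`, when `|ω|, Λ, M, (M²)⁻¹, θ₁⁻¹ ≤ Y`, `R ≤ 12Y³`, `Y ≥ 1`;
* `farEnvelope4_sq_le_pow` — `(2 + 2|ω|R)² + B/η² ≤ (676 + 10⁴c_B⁗)Y^109` and `2ω² + B ≤ (2 + c_B⁗)Y^105`;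
* `nearLength_le_pow` — `L = (25/κ)log(2496Λ/(σ²M²)) ≤ 62400Y⁵` when `κ⁻¹, Λ, |σ|⁻¹, (M²)⁻¹ ≤ Y`,
  `σ²M² ≤ Λ`;
* `invZoneRate_le_pow` — `1/√(θ₁³Λ′/(3584 r²)) ≤ 120Y³` when `0 < r ≤ 2M`, `1 ≤ Λ′`, `M, θ₁⁻¹ ≤ Y`,
  `θ₁ ≤ 1`.

No analysis enters. Near-extremal Kerr programme, crux `KappaExplicitWaveDecay`.

## References
* M. Dafermos, I. Rodnianski, Y. Shlapentokh-Rothman, arXiv:1402.7034 = Ann. of Math. 183 (2016), §8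
  (key `DafermosRodnianskiShlapentokhrothman2014`). Folklore bookkeeping.
-/

noncomputable section

namespace Literature.Geometry.Lorentzian

namespace Kerr

section Bookkeeping

variable {Y ω M θ₁ Λ : ℝ}

/-- The transport exponent of the far envelope restarted at `ζ = θ₁M/4` with `η = θ₁/(100M)` is `4`.
[folklore] -/
theorem expArg_eq_four (hM : 0 < M) (hθ₁ : 0 < θ₁) :
    2 * (θ₁ / (100 * M)) * (50 * M ^ 2 / (θ₁ * M / 4)) = 4 := by
  field_simp
  ring

/-- `e⁴ ≤ 64`. [folklore] -/
theorem exp_four_le : Real.exp 4 ≤ 64 := by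
  rw [show (4:ℝ) = (4:ℕ) * 1 by norm_num, Real.exp_nat_mul]
  have h := Real.exp_one_lt_d9
  have h0 := Real.exp_pos 1
  have h2 : Real.exp 1 ^ 2 ≤ 7.4 := by nlinarith
  have h4 : Real.exp 1 ^ 4 = (Real.exp 1 ^ 2) ^ 2 := by ring
  rw [h4]
  nlinarith [pow_pos h0 2]

/-- Atom consequences: `η⁻¹ ≤ 100Y²`, `η² ≤ Y` (`η = θ₁/(100M)`, `θ₁ ≤ 1`). [folklore] -/
private theorem eta_atoms' (hY : 1 ≤ Y) (hM : 0 < M) (hθ₁ : 0 < θ₁) (hθ₁1 : θ₁ ≤ 1)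
    (hM2i : (M ^ 2)⁻¹ ≤ Y) (hθ₁i : θ₁⁻¹ ≤ Y) (hMY : M ≤ Y) :
    (θ₁ / (100 * M))⁻¹ ≤ 100 * Y ^ 2 ∧ (θ₁ / (100 * M)) ^ 2 ≤ Y := by
  have hY0 : 0 < Y := by linarith
  constructor
  · rw [inv_div]
    calc 100 * M / θ₁ = 100 * (M * θ₁⁻¹) := by rw [div_eq_mul_inv]; ring
      _ ≤ 100 * (Y * Y) := by gcongr
      _ = 100 * Y ^ 2 := by ring
  · have h1 : θ₁ / (100 * M) ≤ M⁻¹ := by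
      rw [div_le_iff₀ (by positivity)]
      have : M⁻¹ * (100 * M) = 100 := by field_simp
      rw [this]; linarith
    have h0 : 0 ≤ θ₁ / (100 * M) := by positivity
    calc (θ₁ / (100 * M)) ^ 2 ≤ (M⁻¹) ^ 2 := pow_le_pow_left₀ h0 h1 2
      _ = (M ^ 2)⁻¹ := by rw [inv_pow]
      _ ≤ Y := hM2i

-- adapted from Literature/Geometry/Lorentzian/CarterThresholdKernelBookkeeping.lean (`farConstant_B_le_pow`)
/-- **`B ≤ c_B⁗ Y^105`** for the far start `ζ = θ₁M/4`, `c_B⁗ = 64·678·(7·10⁴)¹⁶`. [folklore] -/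
theorem farConstant_B4_le_pow (hY : 1 ≤ Y) (hM : 0 < M) (hθ₁ : 0 < θ₁) (hθ₁1 : θ₁ ≤ 1) (hω : |ω| ≤ Y)
    (hΛ : Λ ≤ Y) (hΛ0 : 0 ≤ Λ) (hM2i : (M ^ 2)⁻¹ ≤ Y) (hθ₁i : θ₁⁻¹ ≤ Y) (hMY : M ≤ Y)
    {R : ℝ} (hR0 : 0 ≤ R) (hR : R ≤ 12 * Y ^ 3) :
    ((ω ^ 2 + 6 * Λ / M ^ 2) / (θ₁ / (100 * M)) ^ 2) ^ 16 *
        Real.exp (2 * (θ₁ / (100 * M)) * (50 * M ^ 2 / (θ₁ * M / 4))) *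
        ((θ₁ / (100 * M)) ^ 2 * (2 + 2 * |ω| * R) ^ 2 + 2 * ω ^ 2) ≤
      64 * 678 * (7e4) ^ 16 * Y ^ 105 := by
  have hY0 : 0 < Y := by linarith
  obtain ⟨hηi, hη2⟩ := eta_atoms' hY hM hθ₁ hθ₁1 hM2i hθ₁i hMY
  set η := θ₁ / (100 * M) with hη
  have hη0 : 0 < η := by positivity
  have hω2 : ω ^ 2 ≤ Y ^ 2 := by rw [← sq_abs]; exact pow_le_pow_left₀ (abs_nonneg _) hω 2
  -- `Φ ≤ 7Y²`
  have hΦ : ω ^ 2 + 6 * Λ / M ^ 2 ≤ 7 * Y ^ 2 := by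
    have h1 : 6 * Λ / M ^ 2 ≤ 6 * Y ^ 2 := by
      rw [div_eq_mul_inv]
      calc 6 * Λ * (M ^ 2)⁻¹ ≤ 6 * Y * Y := mul_le_mul (by linarith) hM2i (by positivity) (by positivity)
        _ = 6 * Y ^ 2 := by ring
    linarith
  have hΦ0 : 0 ≤ ω ^ 2 + 6 * Λ / M ^ 2 := by positivity
  have hΦη : (ω ^ 2 + 6 * Λ / M ^ 2) / η ^ 2 ≤ 7e4 * Y ^ 6 := by
    rw [div_eq_mul_inv, ← inv_pow]
    calc (ω ^ 2 + 6 * Λ / M ^ 2) * η⁻¹ ^ 2 ≤ 7 * Y ^ 2 * (100 * Y ^ 2) ^ 2 :=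
          mul_le_mul hΦ (pow_le_pow_left₀ (by positivity) hηi 2) (by positivity) (by positivity)
      _ = 7e4 * Y ^ 6 := by ring
  have h16 : ((ω ^ 2 + 6 * Λ / M ^ 2) / η ^ 2) ^ 16 ≤ (7e4) ^ 16 * Y ^ 96 := by
    calc _ ≤ (7e4 * Y ^ 6) ^ 16 := pow_le_pow_left₀ (by positivity) hΦη 16
      _ = (7e4) ^ 16 * Y ^ 96 := by ring
  -- the exponential is `e⁴ ≤ 64`
  have hexp : Real.exp (2 * η * (50 * M ^ 2 / (θ₁ * M / 4))) ≤ 64 := by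
    rw [hη, expArg_eq_four hM hθ₁]; exact exp_four_le
  -- the last factor `≤ 678 Y⁹`
  have hPf : 2 + 2 * |ω| * R ≤ 26 * Y ^ 4 := by
    have h1 : |ω| * R ≤ Y * (12 * Y ^ 3) := mul_le_mul hω hR hR0 hY0.le
    have h4 : (1 : ℝ) ≤ Y ^ 4 := one_le_pow₀ hY
    nlinarith [h1, h4]
  have hlast : η ^ 2 * (2 + 2 * |ω| * R) ^ 2 + 2 * ω ^ 2 ≤ 678 * Y ^ 9 := by
    have h1 : (2 + 2 * |ω| * R) ^ 2 ≤ (26 * Y ^ 4) ^ 2 := pow_le_pow_left₀ (by positivity) hPf 2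
    have h2 : η ^ 2 * (2 + 2 * |ω| * R) ^ 2 ≤ Y * (26 * Y ^ 4) ^ 2 :=
      mul_le_mul hη2 h1 (by positivity) hY0.le
    have h3 : Y ^ 2 ≤ Y ^ 9 := pow_le_pow_right₀ hY (by norm_num)
    have e : Y * (26 * Y ^ 4) ^ 2 = 676 * Y ^ 9 := by ring
    linarith [h2, hω2, h3, e]
  calc _ ≤ ((7e4) ^ 16 * Y ^ 96) * 64 * (678 * Y ^ 9) := by
        apply mul_le_mul (mul_le_mul h16 hexp (Real.exp_pos _).le (by positivity)) hlast
          (by positivity) (by positivity)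
    _ = 64 * 678 * (7e4) ^ 16 * Y ^ 105 := by ring

-- adapted from Literature/Geometry/Lorentzian/CarterThresholdKernelBookkeeping.lean (`farEnvelope_sq_le_pow`)
/-- **Far-envelope squares** at the start `ζ = θ₁M/4`: with `B ≤ c_B⁗ Y^105`,
`(2 + 2|ω|R)² + B/η² ≤ (676 + 10⁴c_B⁗)Y^109` and `2ω² + B ≤ (2 + c_B⁗)Y^105`. [folklore] -/
theorem farEnvelope4_sq_le_pow (hY : 1 ≤ Y) (hM : 0 < M) (hθ₁ : 0 < θ₁) (hθ₁1 : θ₁ ≤ 1) (hω : |ω| ≤ Y)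
    (hM2i : (M ^ 2)⁻¹ ≤ Y) (hθ₁i : θ₁⁻¹ ≤ Y) (hMY : M ≤ Y) {R B : ℝ} (hR0 : 0 ≤ R) (hR : R ≤ 12 * Y ^ 3)
    (hB : B ≤ 64 * 678 * (7e4) ^ 16 * Y ^ 105) :
    (2 + 2 * |ω| * R) ^ 2 + B / (θ₁ / (100 * M)) ^ 2 ≤ (676 + 1e4 * (64 * 678 * (7e4) ^ 16)) * Y ^ 109 ∧
      2 * ω ^ 2 + B ≤ (2 + 64 * 678 * (7e4) ^ 16) * Y ^ 105 := by
  have hY0 : 0 < Y := by linarith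
  obtain ⟨hηi, -⟩ := eta_atoms' hY hM hθ₁ hθ₁1 hM2i hθ₁i hMY
  set cB : ℝ := 64 * 678 * (7e4) ^ 16 with hcB
  have hω2 : ω ^ 2 ≤ Y ^ 2 := by rw [← sq_abs]; exact pow_le_pow_left₀ (abs_nonneg _) hω 2
  have hPf : 2 + 2 * |ω| * R ≤ 26 * Y ^ 4 := by
    have h1 : |ω| * R ≤ Y * (12 * Y ^ 3) := mul_le_mul hω hR hR0 hY0.le
    have h4 : (1 : ℝ) ≤ Y ^ 4 := one_le_pow₀ hY
    nlinarith [h1, h4]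
  have hPf2 : (2 + 2 * |ω| * R) ^ 2 ≤ 676 * Y ^ 8 := by
    calc _ ≤ (26 * Y ^ 4) ^ 2 := pow_le_pow_left₀ (by positivity) hPf 2
      _ = 676 * Y ^ 8 := by ring
  constructor
  · have h1 : B / (θ₁ / (100 * M)) ^ 2 ≤ cB * Y ^ 105 * (1e4 * Y ^ 4) := by
      rw [div_eq_mul_inv, ← inv_pow]
      refine mul_le_mul hB ?_ (by positivity) (by positivity)
      calc (θ₁ / (100 * M))⁻¹ ^ 2 ≤ (100 * Y ^ 2) ^ 2 := pow_le_pow_left₀ (by positivity) hηi 2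
        _ = 1e4 * Y ^ 4 := by ring
    have h2 : Y ^ 8 ≤ Y ^ 109 := pow_le_pow_right₀ hY (by norm_num)
    have e : cB * Y ^ 105 * (1e4 * Y ^ 4) = 1e4 * cB * Y ^ 109 := by ring
    nlinarith [h1, h2, hPf2, e]
  · have h2 : Y ^ 2 ≤ Y ^ 105 := pow_le_pow_right₀ hY (by norm_num)
    nlinarith [hB, hω2, h2]

/-- **Near length**: `L = (25/κ)log(2496Λ/(σ²M²)) ≤ 62400Y⁵` when `κ⁻¹, Λ, |σ|⁻¹, (M²)⁻¹ ≤ Y`, `σ ≠ 0`,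
`0 < κ`, `0 < M`, `σ²M² ≤ Λ`, `1 ≤ Λ`; also `0 ≤ L`. [folklore] -/
theorem nearLength_le_pow {κ σ : ℝ} (hY : 1 ≤ Y) (hκ : 0 < κ) (hκi : κ⁻¹ ≤ Y) (hΛ1 : 1 ≤ Λ) (hΛ : Λ ≤ Y)
    (hσ : σ ≠ 0) (hσi : |σ|⁻¹ ≤ Y) (hM : 0 < M) (hM2i : (M ^ 2)⁻¹ ≤ Y) (hσΛ : σ ^ 2 * M ^ 2 ≤ Λ) :
    0 ≤ 25 / κ * Real.log (2496 * Λ / (σ ^ 2 * M ^ 2)) ∧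
      25 / κ * Real.log (2496 * Λ / (σ ^ 2 * M ^ 2)) ≤ 62400 * Y ^ 5 := by
  have hσ2 : 0 < σ ^ 2 := by positivity
  have hQ : 1 ≤ 2496 * Λ / (σ ^ 2 * M ^ 2) := by
    rw [le_div_iff₀ (by positivity), one_mul]
    calc σ ^ 2 * M ^ 2 ≤ Λ := hσΛ
      _ ≤ 2496 * Λ := by linarith
  have hQ4 : 2496 * Λ / (σ ^ 2 * M ^ 2) ≤ 2496 * Y ^ 4 := logArg_le_pow hY hΛ hσ hσi hM hM2i
  have hlog0 : 0 ≤ Real.log (2496 * Λ / (σ ^ 2 * M ^ 2)) := Real.log_nonneg hQ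
  refine ⟨mul_nonneg (div_nonneg (by norm_num) hκ.le) hlog0, ?_⟩
  have h1 : Real.log (2496 * Λ / (σ ^ 2 * M ^ 2)) ≤ 2496 * Y ^ 4 := by
    have := Real.log_le_sub_one_of_pos (lt_of_lt_of_le one_pos hQ)
    linarith only [this, hQ4]
  have h2 : 25 / κ ≤ 25 * Y := by
    rw [div_eq_mul_inv]; exact mul_le_mul_of_nonneg_left hκi (by norm_num)
  calc 25 / κ * Real.log (2496 * Λ / (σ ^ 2 * M ^ 2)) ≤ (25 * Y) * (2496 * Y ^ 4) :=
        mul_le_mul h2 h1 hlog0 (by positivity)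
    _ = 62400 * Y ^ 5 := by ring

/-- **Reciprocal zone rate**: `1/√(θ₁³Λ′/(3584 r²)) ≤ 120Y³` when `0 < r ≤ 2M`, `1 ≤ Λ′`, `0 < θ₁ ≤ 1`,
`M, θ₁⁻¹ ≤ Y`, `Y ≥ 1` (`1/k² = 3584r²/(θ₁³Λ′) ≤ 14336 M²θ₁⁻³ ≤ 14336Y⁵ ≤ (120Y³)²`). [folklore] -/
theorem invZoneRate_le_pow {r Λ' : ℝ} (hY : 1 ≤ Y) (hr : 0 < r) (hrM : r ≤ 2 * M) (hΛ' : 1 ≤ Λ')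
    (hθ₁ : 0 < θ₁) (hθ₁i : θ₁⁻¹ ≤ Y) (hMY : M ≤ Y) :
    1 / Real.sqrt (θ₁ ^ 3 * Λ' / (3584 * r ^ 2)) ≤ 120 * Y ^ 3 := by
  have hY0 : 0 < Y := by linarith
  have harg : 0 < θ₁ ^ 3 * Λ' / (3584 * r ^ 2) := by positivity
  set k := Real.sqrt (θ₁ ^ 3 * Λ' / (3584 * r ^ 2)) with hk
  have hk0 : 0 < k := Real.sqrt_pos.2 harg
  have hk2 : k ^ 2 = θ₁ ^ 3 * Λ' / (3584 * r ^ 2) := Real.sq_sqrt harg.le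
  -- `1/k² ≤ 14336 Y⁵`
  have hinv2 : 1 / k ^ 2 ≤ 14336 * Y ^ 5 := by
    rw [hk2, one_div_div]
    rw [div_le_iff₀ (by positivity)]
    have hr2 : r ^ 2 ≤ (2 * M) ^ 2 := pow_le_pow_left₀ hr.le hrM 2
    have hM2 : M ^ 2 ≤ Y ^ 2 := pow_le_pow_left₀ (by linarith [hr.le.trans hrM]) hMY 2
    -- `θ₁³ Y³ ≥ 1`
    have hθY : 1 ≤ θ₁ * Y := by
      have := mul_le_mul_of_nonneg_left hθ₁i hθ₁.le
      rwa [mul_inv_cancel₀ hθ₁.ne'] at this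
    have hθY3 : 1 ≤ (θ₁ * Y) ^ 3 := one_le_pow₀ hθY
    calc 3584 * r ^ 2 ≤ 3584 * (2 * M) ^ 2 := by gcongr
      _ = 14336 * M ^ 2 := by ring
      _ ≤ 14336 * Y ^ 2 := by gcongr
      _ = 14336 * Y ^ 2 * 1 := (mul_one _).symm
      _ ≤ 14336 * Y ^ 2 * ((θ₁ * Y) ^ 3 * Λ') := by
          gcongr
          calc (1:ℝ) = 1 * 1 := (mul_one _).symm
            _ ≤ (θ₁ * Y) ^ 3 * Λ' := mul_le_mul hθY3 hΛ' zero_le_one (zero_le_one.trans hθY3)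
      _ = 14336 * Y ^ 5 * (θ₁ ^ 3 * Λ') := by ring
  -- `1/k ≤ 120 Y³` since `(1/k)² ≤ 14336 Y⁵ ≤ (120Y³)²`
  have h1 : (1 / k) ^ 2 ≤ (120 * Y ^ 3) ^ 2 := by
    rw [div_pow, one_pow]
    calc 1 / k ^ 2 ≤ 14336 * Y ^ 5 := hinv2
      _ ≤ 14400 * Y ^ 6 := by
          have : Y ^ 5 ≤ Y ^ 6 := pow_le_pow_right₀ hY (by norm_num)
          nlinarith [pow_pos hY0 5]
      _ = (120 * Y ^ 3) ^ 2 := by ring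
  exact (pow_le_pow_iff_left₀ (by positivity) (by positivity) two_ne_zero).1 h1

end Bookkeeping

end Kerr

end Literature.Geometry.Lorentzian

end
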